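import Summits.CriticalPhenomena.PercolationContinuityZ3.Theorems.PercNearOneGluingNoHeavyLowerTailBlockQ9Branch
import Summits.CriticalPhenomena.PercolationContinuityZ3.Theorems.PercNearOneGluingNoHeavyLowerTailBlockQ9Certificate
import Summits.CriticalPhenomena.PercolationContinuityZ3.Theorems.PercNearOneGluingNoHeavyLowerTailBlockQ9GeneralThm4
import Summits.CriticalPhenomena.PercolationContinuityZ3.Theorems.PercNearOneGluingAdditiveGluingGoodStep24Engine
import Summits.CriticalPhenomena.PercolationContinuityZ3.Theorems.PercNearOneGluingNoHeavyLowerTailBlockQ9ReliableBlock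
import HarnessLib

/-!
# `NoHeavyLowerTail` (stmt-CriticalPhenomena-4575) — the dynamic-anchor exploration CERTIFICATE as an inductive proof object,
# and its soundness for Kozma–Nitzan's (41)

Support file (lemma factory `prim-lf-1` gen 9; `--supports stmt-CriticalPhenomena-4575`).  One inductive predicate (`BlockQ9.DynCert`,
the certificate calculus of memo FROM-prim-lf-1-gen9.md §6 / HOME/EC-NOTE.md §13) and its soundness theorem; no named facts, no sorries.

A state is `(u, O, a)`: weights `u` (pairs already conditioned closed carry weight `0`), a glued block `O`, an anchor `a`; the target is
`(41)(u,O,a) :≡ μ_{glue_O u}(a ↔ b, O ↔ A) ≤ μ_{glue_O u}(O ↔ b)`.  Constructors = the moves, each discharged by a landed lemma: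
`bin` (`b ∈ O`), `l3` (`blockQ9_of_reliableBlock`), `t4` (`blockThm4_general`), `grow` (`T_branch`; standalone form `blockQ9_grow` in
…BlockQ9DynSteps.lean), `up` (`blockQ9_step` on the split weights; standalone `blockQ9_up`), `switch` (transfer; `blockQ9_switch`).  `DynCert.sound : DynCert A b u O a → (41)(u,O,a)` by induction on the
derivation, so a finite certificate found by the search (lab/gen9/ec9.py `Search9(switch='dyn')`) is ONE kernel-checkable term; with
`q9_of_block_singleton` the root certificate is Kozma–Nitzan's (41) at the observer, and with prim-lf-2's `noHeavyLowerTail_of_question9`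
the universal statement 'every root has a DynCert for its Question-9 relay' (Conjecture EC-dyn) implies the crux.
[cite: KozmaNitzan2024, Lemma 5, Theorem 4, Question 9 (pp. 12–14, 36)]
-/

namespace Summit.CriticalPhenomena.PercolationContinuityZ3.Theorems

open MeasureTheory Set ProbabilityTheory
open Literature.Probability.LatticeModels
open Literature.Probability.Percolation

noncomputable section
open Classical

namespace BlockQ9

variable {n : ℕ}

/-- The dynamic-anchor exploration certificate for `(41)(u, O, a)` (relays `A`, target `b`): leaves `bin` / `l3` / `t4`, branching
`grow` / `up` on a live pair `s(s₀, v)`, and the anchor `switch`.  [cite: KozmaNitzan2024, Question 9 (p. 36)] -/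
inductive DynCert (A : Finset (Fin n)) (b : Fin n) : (Sym2 (Fin n) → unitInterval) → Finset (Fin n) → Fin n → Prop
  | bin {u : Sym2 (Fin n) → unitInterval} {O : Finset (Fin n)} {a : Fin n} (hb : b ∈ O) : DynCert A b u O a
  | l3 {u : Sym2 (Fin n) → unitInterval} {O : Finset (Fin n)} {a : Fin n} (o₀ : Fin n) (ho₀ : o₀ ∈ O)
      (h : (prodBernoulli (fun e : Sym2 (Fin n) => if (∀ x ∈ e, x ∈ O) ∧ ¬ e.IsDiag then 1 else u e)).real (openConn a b) ≤
        (prodBernoulli (fun e : Sym2 (Fin n) => if (∀ x ∈ e, x ∈ O) ∧ ¬ e.IsDiag then 1 else u e)).real (openConn o₀ b)) :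
      DynCert A b u O a
  | t4 {u : Sym2 (Fin n) → unitInterval} {O : Finset (Fin n)} {a : Fin n} (hOA : Disjoint O A) (haO : a ∉ O) (hbO : b ∉ O)
      (hdom : ∀ v : Fin n, v ∉ O → (∃ o ∈ O, u s(o, v) ≠ 0) →
        (prodBernoulli (fun e : Sym2 (Fin n) => if (∃ x ∈ e, x ∈ O) then 0 else u e)).real (openConn a b) ≤
          (prodBernoulli (fun e : Sym2 (Fin n) => if (∃ x ∈ e, x ∈ O) then 0 else u e)).real (openConn v b)) :
      DynCert A b u O a
  | grow {u : Sym2 (Fin n) → unitInterval} {O : Finset (Fin n)} {a : Fin n} (s₀ v : Fin n) (hs₀ : s₀ ∈ O) (hv : v ∉ O)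
      (hopen : DynCert A b u (insert v O) a)
      (hclosed : DynCert A b (fun d : Sym2 (Fin n) => if d = s(s₀, v) then 0 else u d) O a) : DynCert A b u O a
  | up {u : Sym2 (Fin n) → unitInterval} {O : Finset (Fin n)} {a : Fin n} (s₀ v : Fin n) (hs₀ : s₀ ∈ O) (hv : v ∉ O)
      (hyp : (prodBernoulli (fun d : Sym2 (Fin n) => if (∀ x ∈ d, x ∈ O) ∧ ¬ d.IsDiag then 0 else u d)).real (openConn a b) ≤
        (prodBernoulli (fun d : Sym2 (Fin n) => if (∀ x ∈ d, x ∈ O) ∧ ¬ d.IsDiag then 0 else u d)).real (openConn v b))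
      (hclosed : DynCert A b (fun d : Sym2 (Fin n) => if d = s(s₀, v) then 0 else u d) O a) : DynCert A b u O a
  | switch {u : Sym2 (Fin n) → unitInterval} {O : Finset (Fin n)} {a : Fin n} (a' : Fin n)
      (htr : (prodBernoulli (fun d : Sym2 (Fin n) => if (∀ x ∈ d, x ∈ O) ∧ ¬ d.IsDiag then 1 else u d)).real
          (openConn a b ∩ ⋃ o ∈ O, ⋃ x ∈ A, openConn o x) ≤
        (prodBernoulli (fun d : Sym2 (Fin n) => if (∀ x ∈ d, x ∈ O) ∧ ¬ d.IsDiag then 1 else u d)).real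
          (openConn a' b ∩ ⋃ o ∈ O, ⋃ x ∈ A, openConn o x))
      (h : DynCert A b u O a') : DynCert A b u O a

/-- **Soundness of the dynamic-anchor certificate**: a certificate for `(u, O, a)` proves Kozma–Nitzan's (41) for the glued block,
`μ_{glue_O u}(a ↔ b, O ↔ A) ≤ μ_{glue_O u}(O ↔ b)`. [cite: KozmaNitzan2024, Lemma 5, Theorem 4, Question 9 (pp. 12–14, 36)] -/
theorem DynCert.sound {A : Finset (Fin n)} {b : Fin n} {u : Sym2 (Fin n) → unitInterval} {O : Finset (Fin n)} {a : Fin n}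
    (h : DynCert A b u O a) :
    (prodBernoulli (fun d : Sym2 (Fin n) => if (∀ x ∈ d, x ∈ O) ∧ ¬ d.IsDiag then 1 else u d)).real
        (openConn a b ∩ ⋃ o ∈ O, ⋃ x ∈ A, openConn o x) ≤
      (prodBernoulli (fun d : Sym2 (Fin n) => if (∀ x ∈ d, x ∈ O) ∧ ¬ d.IsDiag then 1 else u d)).real
        (⋃ o ∈ O, openConn o b) := by
  induction h with
  | bin hb =>
    rename_i u O a
    have huniv : (⋃ o ∈ O, openConn o b : Set (BondConfig (Fin n))) = univ :=
      eq_univ_of_forall fun ω => mem_iUnion₂.2 ⟨b, hb, (SimpleGraph.Reachable.refl b : (openGraph ω).Reachable b b)⟩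
    rw [huniv, probReal_univ]
    exact measureReal_le_one
  | l3 o₀ ho₀ hle => exact blockQ9_of_reliableBlock _ _ A _ b o₀ ho₀ hle
  | t4 hOA haO hbO hdom => exact blockThm4_general _ _ A _ b hOA haO hbO hdom
  | grow s₀ v hs₀ hv _ _ ihopen ihclosed =>
    rename_i u O a _ _
    -- the branching identity `T_branch`, both children certified
    have hT := T_branch u O A a b s₀ v hs₀ hv
    have h0 : (0 : ℝ) ≤ (u s(s₀, v) : ℝ) := (u s(s₀, v)).2.1
    have h1 : (u s(s₀, v) : ℝ) ≤ 1 := (u s(s₀, v)).2.2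
    nlinarith [mul_nonpos_of_nonneg_of_nonpos h0 (sub_nonpos.2 ihopen),
      mul_nonpos_of_nonneg_of_nonpos (sub_nonneg.2 h1) (sub_nonpos.2 ihclosed)]
  | up s₀ v hs₀ hv hyp _ ihclosed =>
    rename_i u O a _
    -- the up-set exchange on `{s(s₀,v) open}` (`blockQ9_step` for the split weights) + the certified closed child
    set us : Sym2 (Fin n) → unitInterval := fun d => if (∀ x ∈ d, x ∈ O) ∧ ¬ d.IsDiag then 0 else u d with hus
    have hO0 : ∀ e : Sym2 (Fin n), (∀ x ∈ e, x ∈ O) → ¬ e.IsDiag → us e = 0 := by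
      intro e h1 h2; simp only [hus, if_pos (And.intro h1 h2)]
    have hglue : (fun d : Sym2 (Fin n) => if (∀ x ∈ d, x ∈ O) ∧ ¬ d.IsDiag then (1 : unitInterval) else us d) =
        (fun d : Sym2 (Fin n) => if (∀ x ∈ d, x ∈ O) ∧ ¬ d.IsDiag then 1 else u d) := by
      funext d
      by_cases h : (∀ x ∈ d, x ∈ O) ∧ ¬ d.IsDiag
      · simp only [if_pos h]
      · simp only [if_neg h, hus]
    have hglue' : (fun d : Sym2 (Fin n) => if (∀ x ∈ d, x ∈ O) ∧ ¬ d.IsDiag then (1 : unitInterval) else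
          (if d = s(s₀, v) then 0 else us d)) =
        (fun d : Sym2 (Fin n) => if (∀ x ∈ d, x ∈ O) ∧ ¬ d.IsDiag then 1 else (if d = s(s₀, v) then 0 else u d)) := by
      funext d
      by_cases h : (∀ x ∈ d, x ∈ O) ∧ ¬ d.IsDiag
      · simp only [if_pos h]
      · simp only [if_neg h, hus]
    have key := blockQ9_step us O A a b v s₀ hv hs₀ hO0 hyp (by rw [hglue']; exact ihclosed)
    rw [hglue] at key
    exact key
  | switch a' htr _ ih => exact htr.trans ih

/-- **Root form**: a certificate for the singleton block `{o}` proves (41) at the observer `o`: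
`μ_u(a ↔ b, o ↔ A) ≤ μ_u(o ↔ b)`. [cite: KozmaNitzan2024, Question 9 (p. 36)] -/
theorem DynCert.sound_root {A : Finset (Fin n)} {b : Fin n} {u : Sym2 (Fin n) → unitInterval} {o a : Fin n}
    (h : DynCert A b u {o} a) :
    (prodBernoulli u).real (openConn a b ∩ ⋃ x ∈ A, openConn o x) ≤ (prodBernoulli u).real (openConn o b) := by
  have key := h.sound
  rw [goodStep24_glue_singleton] at key
  simpa only [Finset.mem_singleton, iUnion_iUnion_eq_left] using key

end BlockQ9

end

end Summit.CriticalPhenomena.PercolationContinuityZ3.Theorems
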